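import Summits.BirchSwinnertonDyer.BirchSwinnertonDyer.Theorems.KimAtThreeDeepLowerTamagawaLevelLowering
import HarnessLib

/-!
# Route `KimAtThreeKolyvagin` (rung W2), crux `DeepLowerAtThreeOffKatoStratum` (item 19679): «Tamagawa
# divisibility of Kurihara numbers» via LEVEL LOWERING — part 4: the congruence with values in ANY ring /
# field of characteristic `p` (Ribet's level-lowered newform need not have rational coefficients)

Cell `bsd-addord`, seat `bsd-addord-w2-c2` (gen 4, owner of `stmt-BirchSwinnertonDyer-19679`). Part 3
(`KimAtThreeDeepLowerTamagawaLevelLowering`) displays the stabilised level-lowering congruence (LL_m) with a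
`ℤ/p^m`-valued symbol `φ`. In print (Ribet 1990 Thm. 1.1) the level-lowered newform `g` on `Γ₀(N/q)` has
Fourier coefficients in the ring of integers `𝒪` of a number field and the congruence `f ≡ g − g|V_q` holds
modulo a prime `𝔭 ∣ p` of `𝒪`, so the realistic symbol is `𝒪/𝔭`-valued (`𝒪/𝔭 ⊋ 𝔽_p` in general). This file
removes the restriction: the bridge holds for a symbol `φ : ℚ → R` with values in ANY commutative ring `R`
receiving `ℤ/p^k` INJECTIVELY (`kuriharaNumber_eq_zero_of_stabilisedCongruence_ringHom` — apply `ι`, the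
algebra of parts 1–2 is over `R`, pull back by injectivity), in particular for any ring homomorphism
`ℤ/p → F` into a field (automatically injective: `injective_of_zmod_pow_one`). Packaged at depth `m = 1`
(the case in print): **(LL₁^F)** «∃ q ∣ N_E·p, a field `F`, a ring map `ι : ℤ/p → F`, `u ∈ F` and a
`1`-periodic `φ : ℚ → F`, Hecke at every `ℓ ∤ N_E p` with eigenvalue `ι(a_ℓ(E))`, with
`ι([x]⁺_f mod p) = u·(φ(x) − φ(qx))` for all `x`» ⟹ `KuriharaDivisibleAt W p f n 1` for every `n`
(`kuriharaDivisibleAt_one_of_stabilisedCongruence_field`) ⟹ `1 ≤ ∂^{(i)}(δ̃)`, `1 ≤ ∂^{(∞)}(δ̃) ≤ ∂^{(∞)}_{deep}(δ̃)`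
⟹ TamDiv∞ / TamDiv-deep on every row with `v_p(∏ c_ℓ) ≤ 1` ⟹ crux 19679 on the good-ordinary / multiplicative
(ram) tower rows with at most one factor `3` in `∏ c_ℓ` (binders of the registered stub `stub_nonAdditive`
VERBATIM, then the row data and (LL₁^F); named facts `hYZ hW20 hmod hGZK hMaz` / `hSk hmod hGZK hMaz`).

HONEST FRAMING. Theorems only, no definition, no named fact, no `sorry`; (LL₁^F) is DISPLAYED (Ribet 1990 +
mod-`p` multiplicity one (Mazur–Ribet 1991, Wiles 1995 Thm. 2.1; at the prime `q` with `ρ̄` unramified it needs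
`ρ̄(Frob_q)` non-scalar, automatic unless `q ≡ 1 mod p`) + Vatsal 1999 canonical periods — published, untyped);
crux 19679 stays OPEN; BSD is not proved by any of this.

References: [Ribet1990] Thm. 1.1; [MazurRibet1991]; [Wiles1995] Thm. 2.1; [Vatsal1999]; [Ota2018] Prop. 2.3 (1),
Prop. 3.3; [Kim2022StructureSelmer] §1.5.1, Conj. 1.10; [Kim2025RefinedTNC] §8.1.2; [YanZhu2024MainConjNonCM]
Thm. 4.15; [Wuthrich2014] Lemma 20; [Skinner2016PacificMC] Thm. C; [Mazur1978] Cor. 4.1; [Miller2011LMS] Def. 1.1.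
-/

set_option autoImplicit false
-- the Theorems namespace of a single-conjunct summit repeats the summit name by design (D-0017)
set_option linter.dupNamespace false

noncomputable section

open scoped BigOperators Classical MatrixGroups ModularForm

namespace Summit.BirchSwinnertonDyer.BirchSwinnertonDyer.Theorems.KimAtThreeDeepLowerTamagawaLevelLoweringField

open Summit.BirchSwinnertonDyer.BirchSwinnertonDyer.Theorems.KimAtThreeDeepLowerLevelLoweringFibers
  Summit.BirchSwinnertonDyer.BirchSwinnertonDyer.Theorems.KimAtThreeDeepLowerLevelLoweringSums
  Summit.BirchSwinnertonDyer.BirchSwinnertonDyer.Theorems.KimAtThreeDeepLowerTamagawaLevelLowering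

/-! ### §1 The bridge with a ring-valued symbol -/

section Bridge

open Literature.NumberTheory.DiophantineGeometry.Dioph (ratModP)
open CongruenceSubgroup Literature.NumberTheory.EllipticCurves Literature.NumberTheory.EllipticCurves.ModularForms

/-- **A `q`-stabilised congruence with values in a ring `R ⊇ ℤ/p^k` kills the Kurihara number.** As
`kuriharaNumber_eq_zero_of_stabilisedCongruence` (part 3), but the symbol `φ` and the scalar `u` live in any
commutative ring `R` with an INJECTIVE ring map `ι : ℤ/p^k → R`, and the congruence reads
`ι([a/n]⁺_f mod p^k) = u·(φ(a/n) − φ(qa/n))`. [cite: Ota2018, Prop. 2.3 (1) and Prop. 3.3] [cite: Ribet1990, Thm. 1.1] -/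
theorem kuriharaNumber_eq_zero_of_stabilisedCongruence_ringHom {N : ℕ} (f : CuspForm (Gamma0 N) 2)
    (p k : ℕ) (n : ℕ) [NeZero n] (hsq : Squarefree n)
    {R : Type*} [CommRing R] (ι : ZMod (p ^ k) →+* R) (hι : Function.Injective ι)
    (φ : ℚ → R) (u : R) (q : ℕ) (hq : q.Coprime n)
    (hper : ∀ x, φ (x + 1) = φ x)
    (hH : ∀ ℓ ∈ n.primeFactors, ∀ x : ℚ, 2 * φ x = (∑ j : Fin ℓ, φ ((x + j) / ℓ)) + φ (ℓ * x))
    (hC : ∀ a : (ZMod n)ˣ, ι (ratModP (p ^ k) (ratPlusSymbol f ((((a : ZMod n).val : ℚ)) / n))) =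
        u * (φ (((a : ZMod n).val : ℚ) / n) - φ ((q : ℚ) * (a : ZMod n).val / n)))
    (ψ : (ℓ : ℕ) → (ZMod ℓ)ˣ →* Multiplicative (ZMod (p ^ k))) :
    kuriharaNumber f (p ^ k) n ψ = 0 := by
  classical
  apply hι
  rw [map_zero]
  -- the logarithms, pushed to `R`, as `ℓ`-periodic functions on `ℕ`, `0` off the units
  set χ : ℕ → ℕ → R := fun ℓ a =>
    if h : IsUnit (a : ZMod ℓ) then ι (Multiplicative.toAdd (ψ ℓ h.unit)) else 0 with hχdef
  have hχ : ∀ ℓ ∈ n.primeFactors, ∀ a, χ ℓ (a + ℓ) = χ ℓ a := by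
    intro ℓ _ a
    simp only [hχdef, Nat.cast_add, ZMod.natCast_self, add_zero]
  have hunit_eq : ∀ (ℓ : ℕ) (a : ℕ) (ha : IsUnit (a : ZMod ℓ)),
      χ ℓ a = ι (Multiplicative.toAdd (ψ ℓ ha.unit)) := fun ℓ a ha => by
    simp only [hχdef, dif_pos ha]
  have hlog : ∀ ℓ ∈ n.primeFactors, ∀ a b : ℕ, a.Coprime ℓ → b.Coprime ℓ →
      χ ℓ (a * b) = χ ℓ a + χ ℓ b := by
    intro ℓ _ a b ha hb
    have hau : IsUnit (a : ZMod ℓ) := (ZMod.isUnit_iff_coprime a ℓ).mpr ha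
    have hbu : IsUnit (b : ZMod ℓ) := (ZMod.isUnit_iff_coprime b ℓ).mpr hb
    have habu : IsUnit ((a * b : ℕ) : ZMod ℓ) := by
      rw [Nat.cast_mul]
      exact hau.mul hbu
    rw [hunit_eq ℓ _ habu, hunit_eq ℓ _ hau, hunit_eq ℓ _ hbu, ← map_add, ← toAdd_mul, ← map_mul]
    congr 3
    ext
    push_cast [IsUnit.unit_spec]
    rfl
  -- the weight of the tree's `kuriharaNumber`, pushed to `R`, is `∏_{ℓ ∣ n} χ_ℓ(ã)`
  have hw : ∀ a : (ZMod n)ˣ,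
      ι (∏ ℓ ∈ n.primeFactors.attach, Multiplicative.toAdd
        (ψ ℓ.1 (ZMod.unitsMap (Nat.dvd_of_mem_primeFactors ℓ.2) a))) =
        ∏ ℓ ∈ n.primeFactors, χ ℓ (a : ZMod n).val := by
    intro a
    rw [map_prod, ← Finset.prod_attach n.primeFactors (fun ℓ => χ ℓ (a : ZMod n).val)]
    refine Finset.prod_congr rfl fun ℓ _ => ?_
    have hcoe : (((a : ZMod n).val : ℕ) : ZMod ℓ.1) =
        ((ZMod.unitsMap (Nat.dvd_of_mem_primeFactors ℓ.2) a : (ZMod ℓ.1)ˣ) : ZMod ℓ.1) := by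
      haveI : NeZero ℓ.1 := ⟨(Nat.prime_of_mem_primeFactors ℓ.2).ne_zero⟩
      rw [ZMod.unitsMap_def, Units.coe_map, MonoidHom.coe_coe, ZMod.castHom_apply, ZMod.cast_eq_val]
    have hu : IsUnit ((((a : ZMod n).val : ℕ)) : ZMod ℓ.1) := by
      rw [hcoe]
      exact Units.isUnit _
    rw [hunit_eq ℓ.1 _ hu]
    congr 3
    ext
    rw [IsUnit.unit_spec, hcoe]
  rw [kuriharaNumber_def, map_sum]
  simp_rw [map_mul, hw, hC]
  have h0 := kuriharaSum_stabilised_eq_zero (R := R) (χ := χ) hper n hsq hH hχ hlog hq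
  calc ∑ a : (ZMod n)ˣ, u * (φ (((a : ZMod n).val : ℚ) / n) - φ ((q : ℚ) * (a : ZMod n).val / n)) *
        ∏ ℓ ∈ n.primeFactors, χ ℓ (a : ZMod n).val
      = u * ∑ a : (ZMod n)ˣ, (φ (((a : ZMod n).val : ℚ) / n) - φ ((q : ℚ) * (a : ZMod n).val / n)) *
        ∏ ℓ ∈ n.primeFactors, χ ℓ (a : ZMod n).val := by
          rw [Finset.mul_sum]
          exact Finset.sum_congr rfl fun a _ => by ring
    _ = 0 := by rw [h0, mul_zero]

/-- A ring homomorphism from `ℤ/p` (`p` prime, written `ℤ/p^1`) to a field is injective. [folklore] -/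
theorem injective_of_zmod_pow_one (p : ℕ) [Fact p.Prime] {F : Type*} [Field F]
    (ι : ZMod (p ^ 1) →+* F) : Function.Injective ι := by
  haveI : Fact (p ^ 1).Prime := ⟨by rw [pow_one]; exact Fact.out⟩
  exact ι.injective

variable (W : WeierstrassCurve ℚ) [W.IsGloballyMinimal]

/-- **(LL₁^F) ⟹ every Kurihara number vanishes mod `p`** (`KuriharaDivisibleAt W p f n 1` for every `n`):
the depth-`1` stabilised level-lowering congruence with a FIELD-valued Hecke symbol `φ` (values in `𝒪/𝔭`, the
residue field of Ribet's level-lowered newform) — at a Kolyvagin prime of level `1`, `a_ℓ ≡ ℓ + 1 ≡ 2 (mod p)`.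
[cite: Ribet1990, Thm. 1.1] [cite: Ota2018, Prop. 2.3 (1)] [cite: Kim2025RefinedTNC, §8.1.2] -/
theorem kuriharaDivisibleAt_one_of_stabilisedCongruence_field (p : ℕ) [Fact p.Prime] {N : ℕ}
    (f : CuspForm (Gamma0 N) 2) (q : ℕ) (hq : q ∣ W.conductorNorm ℤ * p)
    {F : Type*} [Field F] (ι : ZMod (p ^ 1) →+* F) (u : F) (φ : ℚ → F)
    (hper : ∀ x, φ (x + 1) = φ x)
    (hφH : ∀ ℓ : ℕ, ℓ.Prime → ¬ ℓ ∣ W.conductorNorm ℤ * p → ∀ x : ℚ,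
      ι (W.frobeniusTrace ℓ : ZMod (p ^ 1)) * φ x = (∑ j : Fin ℓ, φ ((x + j) / ℓ)) + φ (ℓ * x))
    (hC : ∀ x : ℚ, ι (ratModP (p ^ 1) (ratPlusSymbol f x)) = u * (φ x - φ (q * x))) (n : ℕ) :
    KuriharaDivisibleAt W p f n 1 := by
  intro k hk hkn ψ _
  haveI : NeZero n := ⟨hkn.ne_zero⟩
  rcases Nat.le_one_iff_eq_zero_or_eq_one.mp hk with rfl | rfl
  · haveI : Subsingleton (ZMod (p ^ 0)) := ZMod.subsingleton_iff.mpr (pow_zero p)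
    exact Subsingleton.elim _ _
  · refine kuriharaNumber_eq_zero_of_stabilisedCongruence_ringHom f p 1 n hkn.squarefree ι
      (injective_of_zmod_pow_one p ι) φ u q ?_ hper ?_ (fun a => by rw [hC, mul_div_assoc]) ψ
    · refine Nat.coprime_of_dvd fun ℓ hℓ hℓq hℓn => ?_
      exact (hkn.isKolyvaginPrime hℓ hℓn).not_dvd (dvd_trans hℓq hq)
    · intro ℓ hℓ x
      have hK := hkn.2 ℓ hℓ
      have h2 : ι (W.frobeniusTrace ℓ : ZMod (p ^ 1)) = 2 := by
        rw [(Kato.isKolyvaginPrime_iff_zmod.mp hK).2.2.2, map_ofNat]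
      rw [← h2]
      exact hφH ℓ hK.prime hK.not_dvd x

/-- **(LL₁^F) ⟹ `1 ≤ ∂^{(i)}(δ̃)` for all `i`, `1 ≤ ∂^{(∞)}(δ̃) ≤ ∂^{(∞)}_{deep}(δ̃)`** — no unit Kurihara number at
any level. [cite: Kim2022StructureSelmer, §1.5.1 (PDF p. 7), Conj. 1.10 (PDF p. 8)] [cite: Kim2025RefinedTNC, §8.1.2] -/
theorem one_le_kuriharaPartials_of_stabilisedCongruence_field (p : ℕ) [Fact p.Prime] {N : ℕ}
    (f : CuspForm (Gamma0 N) 2) (q : ℕ) (hq : q ∣ W.conductorNorm ℤ * p)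
    {F : Type*} [Field F] (ι : ZMod (p ^ 1) →+* F) (u : F) (φ : ℚ → F)
    (hper : ∀ x, φ (x + 1) = φ x)
    (hφH : ∀ ℓ : ℕ, ℓ.Prime → ¬ ℓ ∣ W.conductorNorm ℤ * p → ∀ x : ℚ,
      ι (W.frobeniusTrace ℓ : ZMod (p ^ 1)) * φ x = (∑ j : Fin ℓ, φ ((x + j) / ℓ)) + φ (ℓ * x))
    (hC : ∀ x : ℚ, ι (ratModP (p ^ 1) (ratPlusSymbol f x)) = u * (φ x - φ (q * x))) :
    (∀ i : ℕ, (1 : ℕ∞) ≤ kuriharaPartial W p f i) ∧ (1 : ℕ∞) ≤ kuriharaPartialInfty W p f ∧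
      (1 : ℕ∞) ≤ kuriharaPartialDeepInfty W p f := by
  have hi : ∀ i : ℕ, (1 : ℕ∞) ≤ kuriharaPartial W p f i := fun i =>
    le_iInf fun n => le_iInf fun _ => le_iInf fun _ => by
      exact_mod_cast le_kuriharaDivIndex_of_divisibleAt W p f
        (kuriharaDivisibleAt_one_of_stabilisedCongruence_field W p f q hq ι u φ hper hφH hC n)
  have hinf : (1 : ℕ∞) ≤ kuriharaPartialInfty W p f := le_iInf hi
  exact ⟨hi, hinf, hinf.trans (kuriharaPartialInfty_le_kuriharaPartialDeepInfty W p f)⟩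

end Bridge

/-! ### §2 Crux 19679 on the by-name rows with at most ONE factor `3` in `∏ c_ℓ`, under (LL₁^F) -/

section Rows

open Literature.NumberTheory.DiophantineGeometry.Dioph (ratModP)
open CongruenceSubgroup WeierstrassCurve Literature.NumberTheory.EllipticCurves
  Literature.NumberTheory.EllipticCurves.ModularForms
  Literature.NumberTheory.EllipticCurves.Rank1Residual
  Literature.NumberTheory.EllipticCurves.Rank1Residual.Typed
  Summit.BirchSwinnertonDyer.Rank1Residual
  Summit.BirchSwinnertonDyer.BirchSwinnertonDyer.Theorems.KimAtThreeDeepLowerNonAdditiveRows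
  Summit.BirchSwinnertonDyer.BirchSwinnertonDyer.Theorems.KimAtThreeShallowEqDeepOffStratumNonAdditiveRows

variable (W : WeierstrassCurve ℚ) [W.IsElliptic] [W.IsGloballyMinimal]

omit [W.IsElliptic] in
/-- **TamDiv at exponent `1` from (LL₁^F)**: on a row with `p² ∤ ∏ c_ℓ`, `v_p(∏ c_ℓ) ≤ ∂^{(∞)}(δ̃)` and
`≤ ∂^{(∞)}_{deep}(δ̃)`. [cite: Kim2022StructureSelmer, Conj. 1.10 (PDF p. 8)] [cite: Kim2025RefinedTNC, §8.1.2] -/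
theorem tamagawa_le_kuriharaPartialInfty_of_stabilisedCongruence_field (p : ℕ) [Fact p.Prime] {N : ℕ}
    (f : CuspForm (Gamma0 N) 2) (hv : padicValNat p W.tamagawaProduct ≤ 1)
    (q : ℕ) (hq : q ∣ W.conductorNorm ℤ * p)
    {F : Type*} [Field F] (ι : ZMod (p ^ 1) →+* F) (u : F) (φ : ℚ → F)
    (hper : ∀ x, φ (x + 1) = φ x)
    (hφH : ∀ ℓ : ℕ, ℓ.Prime → ¬ ℓ ∣ W.conductorNorm ℤ * p → ∀ x : ℚ,
      ι (W.frobeniusTrace ℓ : ZMod (p ^ 1)) * φ x = (∑ j : Fin ℓ, φ ((x + j) / ℓ)) + φ (ℓ * x))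
    (hC : ∀ x : ℚ, ι (ratModP (p ^ 1) (ratPlusSymbol f x)) = u * (φ x - φ (q * x))) :
    ((padicValNat p W.tamagawaProduct : ℕ) : ℕ∞) ≤ kuriharaPartialInfty W p f ∧
      ((padicValNat p W.tamagawaProduct : ℕ) : ℕ∞) ≤ kuriharaPartialDeepInfty W p f := by
  have h := one_le_kuriharaPartials_of_stabilisedCongruence_field W p f q hq ι u φ hper hφH hC
  have hv' : ((padicValNat p W.tamagawaProduct : ℕ) : ℕ∞) ≤ (1 : ℕ∞) := by exact_mod_cast hv
  exact ⟨hv'.trans h.2.1, hv'.trans h.2.2⟩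

/-- **Crux 19679 on the GOOD-ORDINARY tower rows with `9 ∤ ∏ c_ℓ` under (LL₁^F)** — binders of the
registered stub `stub_nonAdditive` VERBATIM, then: good ordinary `3`, `v₃(∏ c_ℓ) ≤ 1`, and the field-valued
congruence data `(q, F, ι, u, φ)`; named facts `hYZ hW20 hmod hGZK hMaz` (as in part 3). [cite: YanZhu2024MainConjNonCM, Thm. 4.15 (§4.6)]
[cite: Wuthrich2014, Lemma 20 (p. 399)] [cite: Mazur1978, Cor. 4.1] [cite: Ribet1990, Thm. 1.1] [cite: Kim2025RefinedTNC, §8.1.2] -/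
theorem deepLowerOff_row_goodOrd_of_yanZhu_of_stabilisedCongruence_field
    (hYZ : YanZhu2026.thm415_padicValRat_bsd_rank_le_one)
    (hW20 : Wuthrich2014.lemma20_surjective_threeAdic_of_semistable)
    (hmod : hasEntireLFunction_rat) (hGZK : rank_eq_analyticRank_of_analyticRank_le_one)
    (hMaz : mazur_not_dvd_maninConstant_of_odd) :
    ∀ (W₀ : WeierstrassCurve ℚ) [W₀.IsElliptic] [W₀.IsGloballyMinimal],
      (∀ n : ℕ, W₀.HasSurjectiveModNGaloisRep (3 ^ n : ℕ)) → Finite W₀.sha →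
      ∀ {N : ℕ} [NeZero N], N = W₀.conductorNorm ℤ →
      ∀ (D₀ : ModularParametrizationData W₀ N),
        (∀ z ∈ D₀.L.lattice, ∃ w ∈ periodLattice D₀.f, z = D₀.c * w) →
        (∀ (W₂ : WeierstrassCurve ℚ) [W₂.IsElliptic] (D₂ : ModularParametrizationData W₂ N),
          D₂.f = D₀.f → D₀.modularDegree ≤ D₂.modularDegree) →
        (∀ r : ℚ, ratPlusSymbol D₀.f r ≠ 0 → 0 ≤ padicValRat 3 (ratPlusSymbol D₀.f r)) →
        kuriharaVanishingOrder W₀ 3 D₀.f = 0 →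
        ¬ (haveI : Fact (Nat.Prime 3) := ⟨Nat.prime_three⟩; Addv W₀ 3) →
        W₀.HasGoodReductionAtPrime 3 → ¬ (3 : ℤ) ∣ W₀.frobeniusTrace 3 →
        padicValNat 3 W₀.tamagawaProduct ≤ 1 →
        ∀ (q : ℕ), q ∣ W₀.conductorNorm ℤ * 3 →
        ∀ {F : Type} [Field F] (ι : ZMod (3 ^ 1) →+* F) (u : F) (φ : ℚ → F),
          (∀ x, φ (x + 1) = φ x) →
          (∀ ℓ : ℕ, ℓ.Prime → ¬ ℓ ∣ W₀.conductorNorm ℤ * 3 → ∀ x : ℚ,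
            ι (W₀.frobeniusTrace ℓ : ZMod (3 ^ 1)) * φ x = (∑ j : Fin ℓ, φ ((x + j) / ℓ)) + φ (ℓ * x)) →
          (∀ x : ℚ, ι (ratModP (3 ^ 1) (ratPlusSymbol D₀.f x)) = u * (φ x - φ (q * x))) →
        ∃ d : ℕ, kuriharaPartialDeepInfty W₀ 3 D₀.f = d ∧
          kuriharaPartial W₀ 3 D₀.f 0 ≤
            ((padicValNat 3 (Nat.card (AddCommGroup.primaryComponent W₀.sha 3)) + d : ℕ) : ℕ∞) := by
  intro W₀ _ _ htow hfin N _ hN D₀ hopt _ hint hord hna hgood hord3 hv q hq F _ ι u φ hperφ hφH hC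
  haveI : Fact (Nat.Prime 3) := ⟨Nat.prime_three⟩
  exact deepLowerAtThree_row_goodOrd_of_yanZhu_of_tamagawa_le_deepInfty hYZ hW20 hmod hGZK W₀ htow hfin
    D₀.f D₀.isNewformOf hint hord hgood hord3
    (periodTransfer_three_of_optimal_of_not_addv W₀ hMaz hN D₀ hopt hna)
    (tamagawa_le_kuriharaPartialInfty_of_stabilisedCongruence_field W₀ 3 D₀.f hv q hq ι u φ hperφ hφH hC).2

/-- **Crux 19679 on the MULTIPLICATIVE (ram) tower rows with `9 ∤ ∏ c_ℓ` under (LL₁^F)** — stub binders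
verbatim, then: multiplicative `3`, `Ram W₀ 3`, `v₃(∏ c_ℓ) ≤ 1`, the field-valued congruence data; named facts
`hSk hmod hGZK hMaz`. [cite: Skinner2016PacificMC, Thm. C (§1)] [cite: Mazur1978, Cor. 4.1] [cite: Ribet1990, Thm. 1.1] -/
theorem deepLowerOff_row_mult_of_skinner_of_stabilisedCongruence_field
    (hSk : Skinner2016.thmC_padicValRat_bsd_rank_zero)
    (hmod : hasEntireLFunction_rat) (hGZK : rank_eq_analyticRank_of_analyticRank_le_one)
    (hMaz : mazur_not_dvd_maninConstant_of_odd) :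
    ∀ (W₀ : WeierstrassCurve ℚ) [W₀.IsElliptic] [W₀.IsGloballyMinimal],
      (∀ n : ℕ, W₀.HasSurjectiveModNGaloisRep (3 ^ n : ℕ)) → Finite W₀.sha →
      ∀ {N : ℕ} [NeZero N], N = W₀.conductorNorm ℤ →
      ∀ (D₀ : ModularParametrizationData W₀ N),
        (∀ z ∈ D₀.L.lattice, ∃ w ∈ periodLattice D₀.f, z = D₀.c * w) →
        (∀ (W₂ : WeierstrassCurve ℚ) [W₂.IsElliptic] (D₂ : ModularParametrizationData W₂ N),
          D₂.f = D₀.f → D₀.modularDegree ≤ D₂.modularDegree) →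
        (∀ r : ℚ, ratPlusSymbol D₀.f r ≠ 0 → 0 ≤ padicValRat 3 (ratPlusSymbol D₀.f r)) →
        kuriharaVanishingOrder W₀ 3 D₀.f = 0 →
        ¬ (haveI : Fact (Nat.Prime 3) := ⟨Nat.prime_three⟩; Addv W₀ 3) →
        W₀.HasMultiplicativeReductionAtPrime 3 →
        (haveI : Fact (Nat.Prime 3) := ⟨Nat.prime_three⟩; Ram W₀ 3) →
        padicValNat 3 W₀.tamagawaProduct ≤ 1 →
        ∀ (q : ℕ), q ∣ W₀.conductorNorm ℤ * 3 →
        ∀ {F : Type} [Field F] (ι : ZMod (3 ^ 1) →+* F) (u : F) (φ : ℚ → F),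
          (∀ x, φ (x + 1) = φ x) →
          (∀ ℓ : ℕ, ℓ.Prime → ¬ ℓ ∣ W₀.conductorNorm ℤ * 3 → ∀ x : ℚ,
            ι (W₀.frobeniusTrace ℓ : ZMod (3 ^ 1)) * φ x = (∑ j : Fin ℓ, φ ((x + j) / ℓ)) + φ (ℓ * x)) →
          (∀ x : ℚ, ι (ratModP (3 ^ 1) (ratPlusSymbol D₀.f x)) = u * (φ x - φ (q * x))) →
        ∃ d : ℕ, kuriharaPartialDeepInfty W₀ 3 D₀.f = d ∧
          kuriharaPartial W₀ 3 D₀.f 0 ≤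
            ((padicValNat 3 (Nat.card (AddCommGroup.primaryComponent W₀.sha 3)) + d : ℕ) : ℕ∞) := by
  intro W₀ _ _ htow hfin N _ hN D₀ hopt _ hint hord hna hmult hram hv q hq F _ ι u φ hperφ hφH hC
  haveI : Fact (Nat.Prime 3) := ⟨Nat.prime_three⟩
  exact deepLowerAtThree_row_mult_of_skinner_of_tamagawa_le_deepInfty hSk hmod hGZK W₀ htow hfin
    D₀.f D₀.isNewformOf hint hord hmult hram
    (periodTransfer_three_of_optimal_of_not_addv W₀ hMaz hN D₀ hopt hna)
    (tamagawa_le_kuriharaPartialInfty_of_stabilisedCongruence_field W₀ 3 D₀.f hv q hq ι u φ hperφ hφH hC).2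

end Rows

end Summit.BirchSwinnertonDyer.BirchSwinnertonDyer.Theorems.KimAtThreeDeepLowerTamagawaLevelLoweringField

end
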